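import Summits.CriticalPhenomena.PercolationContinuityZ3.Theorems.PercNearOneGluingNoHeavyLowerTailSahiUnionClosed

/-!
# Sahi's functional on a union-closed block system, IV: the UNION-CLOSED TRUNCATION PRINCIPLE (general block weights)

Support file of the one-cut programme (crux `NoHeavyLowerTail`, stmt-CriticalPhenomena-4575; cell `prim-masterthm`, seat P5 gen 4; report
`P5-LORENTZIAN-TEST.md` §9.3/§9.8).  `…SahiUnionClosed` proved Theorem (U) for Sahi's weight `(|B|−1)!`.  The proof used only three facts: the
insertion identity, the vanishing off a union-closed family, and the SIGN of the full-family sums.  Hence the general principle, for an ARBITRARY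
nonnegative block weight `φ` (e.g. `φ(B) = (|B|−1)!·E_μ[∏_{i∈B} f_i]`, the weight whose full sums are Sahi's `E_{|S|}(f_S)`):

* `Tw φ 𝒜 S := Σ_{π ∈ Part(S), blocks ∈ 𝒜} (−1)^{|π|−1} ∏_{B∈π} φ(B)`;
* `Tw_insert` — `Tw_{𝒜∪{A}}(S) = Tw_𝒜(S) − φ(A)·Tw_𝒜(S ∖ A)` (any family, `A ∉ 𝒜`, `∅ ≠ A ⊆ S`);
* `Tw_eq_zero_of_not_mem` — `𝒜` union-closed, `S ∉ 𝒜` ⇒ `Tw_𝒜(S) = 0`;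
* **`Tw_nonneg_of_full_nonneg`** — THE TRUNCATION PRINCIPLE: if `φ ≥ 0` and the FULL sums are nonnegative on every nonempty `S' ⊆ S`
  (`0 ≤ Tw φ S'.powerset S'`, i.e. "the weight system is Sahi-positive at all orders"), then `0 ≤ Tw φ 𝒜 S` for EVERY union-closed `𝒜`
  (Mathlib `SupClosed`): all-orders Sahi positivity is inherited by every union-closed truncation of the block weights.  Theorem (U) is the case
  `φ(B) = (|B|−1)!` (full sums `= [|S'| = 1] ≥ 0`); for a family of functions that is Sahi-positive at all orders under a weight `μ`
  (e.g. cylinders under a product measure, principal up-sets under an FKG measure — Sahi 2008 Thm 2), every union-closed truncation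
  `B ↦ [B ∈ 𝒜]·(|B|−1)!·E_μ[∏_B f_i]` of its moment system has nonnegative Sahi sums (numerically confirmed, report §9.8).
Everything here is proved; axioms standard.  HONEST LABEL: a combinatorial principle about set-partition sums; it asserts nothing about (M⁺-k) / `C_k`
for general increasing events. [this work]
-/

namespace Summit.CriticalPhenomena.PercolationContinuityZ3.Theorems

namespace SahiUnionClosed

open Finset

variable {ι : Type*} [DecidableEq ι]

/-- Signed product weight of a block system for a general block weight `φ`: `(−1)^{|P|+1} ∏_{B∈P} φ(B)`. [this work] -/
noncomputable def coefW (φ : Finset ι → ℝ) (P : Finset (Finset ι)) : ℝ :=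
  (-1) ^ (P.card + 1) * ∏ B ∈ P, φ B

/-- `Tw φ 𝒜 S`: the `φ`-weighted Sahi sum over the set partitions of `S` with all blocks in `𝒜`. [this work] -/
noncomputable def Tw (φ : Finset ι → ℝ) (𝒜 : Finset (Finset ι)) (S : Finset ι) : ℝ :=
  ∑ π : Finpartition S, if π.parts ⊆ 𝒜 then coefW φ π.parts else 0

omit [DecidableEq ι] in
/-- The empty system weighs `−1`. [folklore] -/
@[simp] theorem coefW_empty (φ : Finset ι → ℝ) : coefW φ (∅ : Finset (Finset ι)) = -1 := by
  simp [coefW]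

/-- Inserting a new block multiplies the weight by `−φ(A)`. [folklore] -/
theorem coefW_insert (φ : Finset ι → ℝ) {A : Finset ι} {P : Finset (Finset ι)} (h : A ∉ P) :
    coefW φ (insert A P) = -φ A * coefW φ P := by
  simp only [coefW, card_insert_of_notMem h, prod_insert h, pow_succ]
  ring

/-- Block bijection, real-valued summands (cf. `sum_ite_mem_parts`). [folklore] -/
theorem sum_ite_mem_parts_real {S A : Finset ι} (hA : A.Nonempty) (hAS : A ⊆ S) (g : Finset (Finset ι) → ℝ) :
    (∑ π : Finpartition S, if A ∈ π.parts then g (π.parts.erase A) else 0)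
      = ∑ π' : Finpartition (S \ A), g π'.parts := by
  rw [← Finset.sum_filter]
  refine Finset.sum_bij' (fun π hπ => dropBlock π (Finset.mem_filter.1 hπ).2)
    (fun π' _ => addBlock hA hAS π') ?_ ?_ ?_ ?_ ?_
  · intro π hπ; exact mem_univ _
  · intro π' _
    exact Finset.mem_filter.2 ⟨mem_univ _, by simp⟩
  · intro π hπ
    have hA' : A ∈ π.parts := (Finset.mem_filter.1 hπ).2
    ext B
    simp [insert_erase hA']
  · intro π' _
    ext B
    simp [erase_insert (not_mem_parts_of_sdiff hA π')]
  · intro π hπ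
    simp

/-- Only blocks inside `S` matter. [folklore] -/
theorem Tw_filter_subset (φ : Finset ι → ℝ) (𝒜 : Finset (Finset ι)) (S : Finset ι) :
    Tw φ 𝒜 S = Tw φ (𝒜.filter (· ⊆ S)) S := by
  unfold Tw
  refine Finset.sum_congr rfl fun π _ => ?_
  have : π.parts ⊆ 𝒜 ↔ π.parts ⊆ 𝒜.filter (· ⊆ S) :=
    ⟨fun h B hB => Finset.mem_filter.2 ⟨h hB, π.le hB⟩, fun h B hB => (Finset.mem_filter.1 (h hB)).1⟩
  simp only [this]

/-- Enlarging the family by blocks that cannot occur (not subsets of `S`) does not change `Tw`. [folklore] -/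
theorem Tw_eq_of_filter_eq (φ : Finset ι → ℝ) {𝒜 ℬ : Finset (Finset ι)} {S : Finset ι}
    (h : 𝒜.filter (· ⊆ S) = ℬ.filter (· ⊆ S)) : Tw φ 𝒜 S = Tw φ ℬ S := by
  rw [Tw_filter_subset φ 𝒜, Tw_filter_subset φ ℬ, h]

/-- `Tw φ 𝒜 ∅ = −1`. [folklore] -/
theorem Tw_empty (φ : Finset ι → ℝ) (𝒜 : Finset (Finset ι)) : Tw φ 𝒜 (∅ : Finset ι) = -1 := by
  unfold Tw
  have h1 : ∀ π : Finpartition (∅ : Finset ι), π.parts = ∅ := fun π =>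
    (Finpartition.parts_eq_empty_iff).2 rfl
  have : (Finset.univ : Finset (Finpartition (∅ : Finset ι))) = {(Finpartition.empty _ : Finpartition (⊥ : Finset ι))} := by
    apply Finset.eq_singleton_iff_unique_mem.2
    refine ⟨mem_univ _, fun π _ => ?_⟩
    ext B; simp [h1 π, Finpartition.empty]
  rw [this, Finset.sum_singleton]
  simp [Finpartition.empty]

/-- **Insertion identity** for a general weight: `Tw_{𝒜 ∪ {A}}(S) = Tw_𝒜(S) − φ(A)·Tw_𝒜(S ∖ A)` (`A ∉ 𝒜`, `∅ ≠ A ⊆ S`). [this work] -/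
theorem Tw_insert (φ : Finset ι → ℝ) {𝒜 : Finset (Finset ι)} {A S : Finset ι} (hA𝒜 : A ∉ 𝒜) (hA : A.Nonempty) (hAS : A ⊆ S) :
    Tw φ (insert A 𝒜) S = Tw φ 𝒜 S - φ A * Tw φ 𝒜 (S \ A) := by
  set g : Finset (Finset ι) → ℝ := fun P => if P ⊆ 𝒜 then -φ A * coefW φ P else 0 with hg
  have key : ∀ π : Finpartition S,
      (if π.parts ⊆ insert A 𝒜 then coefW φ π.parts else 0)
        = (if π.parts ⊆ 𝒜 then coefW φ π.parts else 0) + (if A ∈ π.parts then g (π.parts.erase A) else 0) := by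
    intro π
    simp only [Finset.subset_insert_iff]
    by_cases hAπ : A ∈ π.parts
    · have hnot : ¬ π.parts ⊆ 𝒜 := fun h => hA𝒜 (h hAπ)
      simp only [hAπ, if_true, hnot, if_false, zero_add, hg]
      by_cases hsub : π.parts.erase A ⊆ 𝒜
      · rw [if_pos hsub, if_pos hsub]
        conv_lhs => rw [← insert_erase hAπ]
        rw [coefW_insert φ (notMem_erase A π.parts)]
      · rw [if_neg hsub, if_neg hsub]
    · simp only [hAπ, if_false, add_zero, erase_eq_of_notMem hAπ]
  have h1 : Tw φ (insert A 𝒜) S = Tw φ 𝒜 S + ∑ π : Finpartition S, (if A ∈ π.parts then g (π.parts.erase A) else 0) := by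
    unfold Tw; rw [← Finset.sum_add_distrib]; exact Finset.sum_congr rfl fun π _ => key π
  have h3 : (∑ π' : Finpartition (S \ A), g π'.parts) = -φ A * Tw φ 𝒜 (S \ A) := by
    unfold Tw; rw [Finset.mul_sum]
    refine Finset.sum_congr rfl fun π' _ => ?_
    simp only [hg]; split_ifs <;> ring
  rw [h1, sum_ite_mem_parts_real hA hAS g, h3]
  ring

/-- **Vanishing off a union-closed family** (general weight). [this work] -/
theorem Tw_eq_zero_of_not_mem (φ : Finset ι → ℝ) {𝒜 : Finset (Finset ι)} (h𝒜 : SupClosed (𝒜 : Set (Finset ι))) {S : Finset ι}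
    (hS : S.Nonempty) (hS𝒜 : S ∉ 𝒜) : Tw φ 𝒜 S = 0 := by
  unfold Tw
  refine Finset.sum_eq_zero fun π _ => ?_
  rw [if_neg]
  intro hsub
  have hne : π.parts.Nonempty := π.parts_nonempty (by rw [Finset.bot_eq_empty]; exact hS.ne_empty)
  have hmem : π.parts.sup' hne id ∈ (↑𝒜 : Set (Finset ι)) :=
    Finset.sup'_mem (↑𝒜 : Set (Finset ι)) (fun A hA B hB => h𝒜 hA hB) π.parts hne id (fun B hB => hsub hB)
  rw [Finset.sup'_eq_sup, π.sup_parts] at hmem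
  exact hS𝒜 hmem

/-- **THE UNION-CLOSED TRUNCATION PRINCIPLE** (induction form): for a nonnegative weight whose FULL Sahi sums are nonnegative on every nonempty
`S' ⊆ S`, every union-closed family of subsets of `S` has `Tw ≥ 0`. [this work] -/
theorem Tw_nonneg_aux (φ : Finset ι → ℝ) (hφ : ∀ B, 0 ≤ φ B) :
    ∀ (n : ℕ) (S : Finset ι), S.card = n → (∀ S', S' ⊆ S → S'.Nonempty → 0 ≤ Tw φ S'.powerset S') →
    ∀ (m : ℕ) (𝒜 : Finset (Finset ι)), ((S.powerset.erase ∅) \ 𝒜).card = m → SupClosed (𝒜 : Set (Finset ι)) →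
    (∀ B ∈ 𝒜, B ⊆ S) → S.Nonempty → 0 ≤ Tw φ 𝒜 S := by
  intro n
  induction n using Nat.strong_induction_on with
  | _ n ihn =>
    intro S hSn hfullS m
    induction m using Nat.strong_induction_on with
    | _ m ihm =>
      intro 𝒜 hm h𝒜 h𝒜S hS
      by_cases hS𝒜 : S ∈ 𝒜
      swap
      · rw [Tw_eq_zero_of_not_mem φ h𝒜 hS hS𝒜]
      by_cases hm0 : ((S.powerset.erase ∅) \ 𝒜) = ∅
      · -- full family: `𝒜` and `S.powerset` have the same members among the blocks that can occur
        have hfull : ∀ B, B ⊆ S → B.Nonempty → B ∈ 𝒜 := fun B hBS hBne => by_contra fun hB =>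
          Finset.eq_empty_iff_forall_notMem.1 hm0 B (mem_sdiff.2 ⟨mem_erase.2 ⟨hBne.ne_empty, mem_powerset.2 hBS⟩, hB⟩)
        have heq : Tw φ 𝒜 S = Tw φ S.powerset S := by
          unfold Tw
          refine Finset.sum_congr rfl fun π _ => ?_
          have h1 : π.parts ⊆ 𝒜 := fun B hB => hfull B (π.le hB) (π.nonempty_of_mem_parts hB)
          have h2 : π.parts ⊆ S.powerset := fun B hB => mem_powerset.2 (π.le hB)
          rw [if_pos h1, if_pos h2]
        rw [heq]; exact hfullS S subset_rfl hS
      · obtain ⟨A, hAmem, hAmax⟩ := exists_max_image _ Finset.card (nonempty_iff_ne_empty.2 hm0)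
        rcases mem_sdiff.1 hAmem with ⟨hA1, hA𝒜⟩
        rcases mem_erase.1 hA1 with ⟨hAne, hApow⟩
        have hAS : A ⊆ S := mem_powerset.1 hApow
        have hAne' : A.Nonempty := nonempty_iff_ne_empty.2 hAne
        have hAneS : A ≠ S := fun h => hA𝒜 (h ▸ hS𝒜)
        have hmax' : ∀ C, A ⊆ C → C ⊆ S → C ∈ insert A 𝒜 := fun C hAC hCS => by
          by_cases hCA : C = A
          · exact hCA ▸ mem_insert_self _ _
          · refine mem_insert_of_mem (by_contra fun hC => ?_)
            have h1 := hAmax C (mem_sdiff.2 ⟨mem_erase.2 ⟨(hAne'.mono hAC).ne_empty, mem_powerset.2 hCS⟩, hC⟩)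
            exact absurd (card_lt_card (lt_of_le_of_ne hAC (Ne.symm hCA))) (not_lt.2 h1)
        have hAS' : ∀ B ∈ insert A 𝒜, B ⊆ S := fun B hB => by
          rcases mem_insert.1 hB with rfl | hB'
          exacts [hAS, h𝒜S B hB']
        have hUC : SupClosed (↑(insert A 𝒜) : Set (Finset ι)) := by
          intro B hB C hC
          rw [Finset.mem_coe] at hB hC ⊢
          have hBCS : B ∪ C ⊆ S := union_subset (hAS' B hB) (hAS' C hC)
          rcases mem_insert.1 hB with rfl | hB'
          · exact hmax' _ subset_union_left hBCS
          rcases mem_insert.1 hC with rfl | hC'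
          · exact hmax' _ subset_union_right hBCS
          exact mem_insert_of_mem (h𝒜 hB' hC')
        have hlt : ((S.powerset.erase ∅) \ insert A 𝒜).card < m := by
          rw [← hm]
          refine card_lt_card ⟨sdiff_subset_sdiff subset_rfl (subset_insert _ _), fun h => ?_⟩
          exact (mem_sdiff.1 (h hAmem)).2 (mem_insert_self _ _)
        have hbig : 0 ≤ Tw φ (insert A 𝒜) S := ihm _ hlt (insert A 𝒜) rfl hUC hAS' hS
        have hsmall : 0 ≤ Tw φ 𝒜 (S \ A) := by
          rw [Tw_filter_subset]
          refine ihn (S \ A).card (by rw [← hSn]; exact card_lt_card (sdiff_ssubset hAS hAne')) (S \ A) rfl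
            (fun S' hS' hS'ne => hfullS S' (hS'.trans sdiff_subset) hS'ne) _
            (𝒜.filter (· ⊆ S \ A)) rfl (supClosed_filter_subset h𝒜 _) (fun B hB => (Finset.mem_filter.1 hB).2) ?_
          exact Finset.sdiff_nonempty.2 fun h => hAneS (subset_antisymm hAS h)
        rw [show Tw φ 𝒜 S = Tw φ (insert A 𝒜) S + φ A * Tw φ 𝒜 (S \ A) by
          rw [Tw_insert φ hA𝒜 hAne' hAS]; ring]
        exact add_nonneg hbig (mul_nonneg (hφ A) hsmall)

/-- **THE UNION-CLOSED TRUNCATION PRINCIPLE.**  Let `φ ≥ 0` be a block weight whose full Sahi sums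
`Σ_{π ∈ Part(S')} (−1)^{|π|−1} ∏_{B∈π} φ(B)` are nonnegative for every nonempty `S' ⊆ S` ("Sahi-positive at all orders").  Then for every family `𝒜`
closed under pairwise unions, the truncated sum `Σ_{π ∈ Part(S), blocks ∈ 𝒜} (−1)^{|π|−1} ∏_{B∈π} φ(B)` is nonnegative. [this work] -/
theorem Tw_nonneg_of_full_nonneg (φ : Finset ι → ℝ) (hφ : ∀ B, 0 ≤ φ B) {S : Finset ι}
    (hfull : ∀ S', S' ⊆ S → S'.Nonempty → 0 ≤ Tw φ S'.powerset S')
    {𝒜 : Finset (Finset ι)} (h𝒜 : SupClosed (𝒜 : Set (Finset ι))) (hS : S.Nonempty) : 0 ≤ Tw φ 𝒜 S := by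
  rw [Tw_filter_subset]
  exact Tw_nonneg_aux φ hφ S.card S rfl hfull _ (𝒜.filter (· ⊆ S)) rfl (supClosed_filter_subset h𝒜 S)
    (fun B hB => (Finset.mem_filter.1 hB).2) hS

/-- Sahi's weight is the factorial instance: `T 𝒜 S = Tw (B ↦ (|B|−1)!) 𝒜 S`. [this work] -/
theorem T_eq_Tw (𝒜 : Finset (Finset ι)) (S : Finset ι) :
    (T 𝒜 S : ℝ) = Tw (fun B : Finset ι => ((B.card - 1).factorial : ℝ)) 𝒜 S := by
  unfold T Tw coefP coefW
  push_cast
  refine Finset.sum_congr rfl fun π _ => ?_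
  split_ifs <;> simp

end SahiUnionClosed

end Summit.CriticalPhenomena.PercolationContinuityZ3.Theorems
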